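import Summits.Ventures.PercRepro.ProfilePointedDirectSumClosure

/-!
# PercRepro — (Ĉ) AT EVERY POINT OF AN EXTENSION-HOMOGENEOUS MATROID, AND OF DIRECT SUMS OF SUCH
(p10, gen 23; `proofs/P10-DIRECTSUM-g23.md` §5; modulo Theorem A = the named fact)

Gen 13's `pointed_average_of_fact` is the AVERAGE of (Ĉ) over the point:
`N·(N − k − 1)·P_k ≤ N·k·P_{k+1} + (N − 2k − 1)·Σ_{q ∈ E} c^q_k`.  When the extension counts at level `k` do not
depend on the point (`Σ_q c^q_k = N·c^p_k`), dividing by `N` is (Ĉ) at `(M, p, k)` itself.  THIS FILE records that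
and its consequences, all CONDITIONAL on the named fact and on nothing else:

* `pointedRow_of_extCount_const` — (Ĉ) at `(M, p, k)` when `c^q_k = c^p_k` for every `q ∈ E`;
* `ExtHomogeneous M` (DEF) — the extension counts are point-independent at every level (every matroid with a
  point-transitive automorphism group: the uniform matroids, the projective geometries, `M(K_n)`, …);
  `pointedRowAt_of_extHomogeneous` — (Ĉ) at every level of every point of such a matroid;
* `pointedRowAt_disjointSum_of_extHomogeneous` — (Ĉ) at every level of EVERY point of `M₁ ⊕ M₂` when both
  summands are extension-homogeneous (the direct-sum theorem of `ProfilePointedDirectSumClosure.lean`, on the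
  summand containing the point; `Matroid.disjointSum_comm` for a point of `M₂`) — e.g. every direct sum of two
  uniform matroids.

Nothing here asserts (Ĉ).
-/

open scoped Matroid

namespace PercRepro.Cogirth

open Finset ThmH Skew

variable {α : Type} [DecidableEq α]

/-- **(Ĉ) FROM ITS AVERAGE** (CONDITIONAL on the named fact): if every point of `M` has the same extension count at
level `k` as `p`, then (Ĉ) holds at `(M, p, k)` — `pointed_average_of_fact` divided by `#E`. -/
theorem pointedRow_of_extCount_const (hfact : BiIndepDensityLogConcave α) (M : Matroid α) [M.Finite] {p : α}
    (hp : p ∈ gr M) (k : ℕ) (hk : 2 * k + 2 ≤ (gr M).card)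
    (hconst : ∀ q ∈ gr M, extCount M k q = extCount M k p) :
    ((gr M).card - k - 1) * (biIndepSets M k).card ≤
      k * (biIndepSets M (k + 1)).card + ((gr M).card - 2 * k - 1) * extCount M k p := by
  have h := pointed_average_of_fact hfact M k hk
  rw [Finset.sum_congr rfl hconst, Finset.sum_const, smul_eq_mul] at h
  have hN : 0 < (gr M).card := card_pos.2 ⟨p, hp⟩
  have h' : (gr M).card * (((gr M).card - k - 1) * (biIndepSets M k).card) ≤
      (gr M).card * (k * (biIndepSets M (k + 1)).card + ((gr M).card - 2 * k - 1) * extCount M k p) := by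
    calc (gr M).card * (((gr M).card - k - 1) * (biIndepSets M k).card)
        = (gr M).card * ((gr M).card - k - 1) * (biIndepSets M k).card := by ring
      _ ≤ (gr M).card * k * (biIndepSets M (k + 1)).card +
            ((gr M).card - 2 * k - 1) * ((gr M).card * extCount M k p) := h
      _ = (gr M).card * (k * (biIndepSets M (k + 1)).card +
            ((gr M).card - 2 * k - 1) * extCount M k p) := by ring
  exact Nat.le_of_mul_le_mul_left h' hN

/-- (Ĉ) at every level of `(M, p)` when the extension counts are point-independent at every level. -/
theorem pointedRowAt_of_extCount_const (hfact : BiIndepDensityLogConcave α) (M : Matroid α) [M.Finite] {p : α}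
    (hp : p ∈ gr M) (hconst : ∀ k, ∀ q ∈ gr M, extCount M k q = extCount M k p) : PointedRowAt M p :=
  fun k hk => pointedRow_of_extCount_const hfact M hp k hk (hconst k)

/-- **Extension-homogeneity**: the extension counts `c^p_k` do not depend on the point `p ∈ E`, at any level — e.g.
every matroid whose automorphism group is transitive on the points. -/
def ExtHomogeneous (M : Matroid α) [M.Finite] : Prop :=
  ∀ k : ℕ, ∀ p ∈ gr M, ∀ q ∈ gr M, extCount M k p = extCount M k q

/-- **(Ĉ) AT EVERY POINT OF AN EXTENSION-HOMOGENEOUS MATROID** (CONDITIONAL on the named fact). -/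
theorem pointedRowAt_of_extHomogeneous (hfact : BiIndepDensityLogConcave α) (M : Matroid α) [M.Finite]
    (hM : ExtHomogeneous M) {p : α} (hp : p ∈ gr M) : PointedRowAt M p :=
  pointedRowAt_of_extCount_const hfact M hp (fun k q hq => hM k q hq p hp)

/-- `PointedRowAt` transports along an equality of matroids (the finiteness instances are proofs). -/
theorem pointedRowAt_congr {M N : Matroid α} [M.Finite] [N.Finite] (h : M = N) {p : α} :
    PointedRowAt M p ↔ PointedRowAt N p := by
  subst h
  exact Iff.rfl

/-- **(Ĉ) AT EVERY POINT OF A DIRECT SUM OF EXTENSION-HOMOGENEOUS MATROIDS** (CONDITIONAL on the named fact): the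
direct-sum theorem on the summand containing the point. -/
theorem pointedRowAt_disjointSum_of_extHomogeneous (hfact : BiIndepDensityLogConcave α) {M₁ M₂ : Matroid α}
    [M₁.Finite] [M₂.Finite] (h : Disjoint M₁.E M₂.E) [(M₁.disjointSum M₂ h).Finite]
    (h₁ : ExtHomogeneous M₁) (h₂ : ExtHomogeneous M₂) {p : α} (hp : p ∈ gr (M₁.disjointSum M₂ h)) :
    PointedRowAt (M₁.disjointSum M₂ h) p := by
  rw [gr_disjointSum h, mem_union] at hp
  rcases hp with hp | hp
  · exact pointedRowAt_disjointSum_of_fact hfact h hp (pointedRowAt_of_extHomogeneous hfact M₁ h₁ hp)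
  · haveI : (M₂.disjointSum M₁ h.symm).Finite := disjointSum_finite M₂ M₁ h.symm
    rw [pointedRowAt_congr (Matroid.disjointSum_comm (h := h))]
    exact pointedRowAt_disjointSum_of_fact hfact h.symm hp (pointedRowAt_of_extHomogeneous hfact M₂ h₂ hp)

end PercRepro.Cogirth
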